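import Mathlib
import Summits.Ventures.PercRepro2.FiveTypedCover
import Summits.Ventures.PercRepro2.FiveTypedEdges
import Summits.Ventures.PercRepro2.FourTypedAll

/-!
# Five typed edges: the finite statements discharged (blind cell PercRepro2, night-3, 2026-08-24)

With `allOk4_true` (`FourTypedAll`) and `allOk5_true` (`FiveTypedCover`), the five-edge theorem is
unconditional: row 2′TRI with five typed edges on every finite graph, marking, pinning and type
vector (`typedCount_quint_K3_nonneg'`), `TypedBases` for `|F| ≤ 5`
(`typedCount_nonneg_of_card_le_five'`).
-/

namespace Summit.Ventures.PercRepro2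

open UnionCluster

namespace CovForm

namespace TwoTyped

open OneTyped TypedRed

section Unconditional5

variable {V : Type*} {E : Type*} [Fintype E] [DecidableEq E] {R : Type*} [Field R]
  [LinearOrder R] [IsStrictOrderedRing R] (ends : E → Sym2 V) (o a₁ a₂ a₃ b : V)

/-- **Five typed edges**: the typed count of `K₃` with five distinct typed edges is nonnegative
(row 2′TRI, `|F| = 5`, kernel-checked). -/
theorem typedCount_quint_K3_nonneg' (e : Fin 5 → E) (hinj : Function.Injective e) (z : Config E)
    (τ : E → ℕ) (hτ : ∀ i, τ (e i) = 1 ∨ τ (e i) = 2) :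
    0 ≤ typedCount (Finset.univ.image e) z τ (K3 ends o a₁ a₂ a₃ b : Config E → Config E → Config E → R) :=
  typedCount_quint_K3_nonneg ends o a₁ a₂ a₃ b allOk4_true allOk5_true e hinj z τ hτ

/-- **`TypedBases` for at most five typed edges** (row 2′TRI, `|F| ≤ 5`, kernel-checked). -/
theorem typedCount_nonneg_of_card_le_five' (F : Finset E) (hF : F.card ≤ 5) (z : Config E)
    (τ : E → ℕ) (hτ : ∀ e ∈ F, τ e = 1 ∨ τ e = 2) :
    0 ≤ typedCount F z τ (K3 ends o a₁ a₂ a₃ b : Config E → Config E → Config E → R) :=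
  typedCount_nonneg_of_card_le_five ends o a₁ a₂ a₃ b allOk4_true allOk5_true F hF z τ hτ

end Unconditional5

end TwoTyped

end CovForm

end Summit.Ventures.PercRepro2
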